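import Summits.SmoothPoincare4.SmoothPoincare4.Theses.EntropyRung
import Summits.SmoothPoincare4.SmoothPoincare4.Theorems.SubcylindricalExistence.Negative.ConstTest
import Summits.SmoothPoincare4.SmoothPoincare4.Theorems.SubcylindricalExistence.Negative.Window
import Summits.SmoothPoincare4.SmoothPoincare4.Theorems.SubcylindricalExistence.Negative.Logic

/-!
# Line `fat-conical-core-avr-logsobolev` for the crux `EntropyRung.SubcylindricalExistence` (stmt-SmoothPoincare4-10871)

Skeleton (crux-plan, round 1, 2026-08-16).  ENT := every closed smooth homotopy 4-sphere `M` carries a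
Riemannian metric with `R > 0` and `ν(g) > ν_cyl = log Θ(S³×ℝ) = log 2 + ½ log π − 3/2`.

The idea card's lever made exact.  The sharp AVR-weighted logarithmic Sobolev inequality on complete
`Ric ≥ 0` manifolds (Balogh–Kristály–Tripaldi, arXiv:2210.15774, Thm 1.1, `p = 2`, `N = 4`, constant
`𝓛_{2,4} AVR^{-1/2}`, `𝓛_{2,4} = 1/(2πe)`; on Brendle's isoperimetric inequality arXiv:2009.13717 Cor 1.3)
is, after optimising the scale, Perelman's `𝒲(h, ·, τ) ≥ log AVR(h)` at EVERY `τ > 0` with no stray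
constant (triage r1-1/2/3 redid the computation; θ = 1 returns `μ(ℝ⁴, τ) = 0`).  So ONE asymptotic
number of a `Ric ≥ 0` metric on the punctured homotopy sphere produces the whole scale-uniform entropy
floor, and ENT follows from

* `stub_avrEntropyFloor` — BKT Thm 1.1 in `𝒲`-normalisation (published theorem; Literature-fact sized);
* `stub_fatConeCore` — the transferred crux C⁺ (SPC4-hard, the line's bet): `M ∖ {p}` carries a complete
  `Ric ≥ 0` metric which is EXACTLY the flat cone `dr² + c²r² g_{S³}` (`= c²δ + (1−c²)dr²` in a Cartesian
  chart `ψ` of `{‖x‖ > ρ₀}`) outside a compact set, with `c³ = AVR > Θ(S³×ℝ) = 2√π e^{−3/2} = 0.791`,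
  the cone chart being the INVERSION of a smooth polar chart `β` of `M` at `p` (`β y = ι (ψ (y/‖y‖²))`) —
  this compatibility is what lets the cap be glued inside `M` itself (capping an ABSTRACT conical end of
  `M ∖ {p}` only gives a metric on a closed `M₁` with `M₁ # Σ' ≅ M` for an unknown homotopy sphere `Σ'`
  — the region between the cone's sphere and a small chart sphere at `p` is an h-cobordism that is a
  product iff a smooth 4-d Schoenflies instance holds; cf. `Literature/Barriers/SmoothPoincare4/ExoticOpenFourSpace.lean`);
* `stub_coneCapping` — the CLOSING lemma (triage r1-2 (2)/(3), r1-3: load-bearing): truncate the cone at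
  `r = ρ → ∞`, open it logarithmically slowly to slope `1 − ε` keeping `R = 6[(1−φ'²)/φ² − φ''/φ] > 0`
  (`φφ'' < 1 − φ'²`), and close with the round cap it then fits — a sphere of radius `A = φ/√(2ε) → ∞`,
  so the closed manifold is a huge round `S⁴(A)` with a tiny pimple containing the core; localisation of
  `𝒲` with `Σχ² = 1` cut-offs (IMS formula + concavity of entropy: the mixing term has the right sign),
  logarithmic cut-offs absorbed by the 4-d Hardy inequality, and Holley–Stroock stability under the
  `(1+o(1))`-bi-Lipschitz comparison of each opening annulus with an exact cone give
  `ν ≥ min(3 log c, ν_round) − o(1) > ν_cyl`, with `R ≥ 0` everywhere and `R > 0` off the core;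
* `stub_scalarPositiveUpgrade` — `R ≥ 0`, `R ≢ 0`, `ν > ν₀` on a closed 4-manifold ⇒ a nearby metric
  with `R > 0`, `ν > ν₀` (conformal factor `1 + εv`, `−6Δv = R_avg − R`; `μ` is continuous on compact
  `τ`-windows, `→ 0⁻` as `τ → 0` locally uniformly, `→ +∞` as `τ → ∞` once `λ₁(−4Δ + R) > 0`) — the
  "one-line fix" asked for by triage r1-1 (2), stated once for every existence line of this crux.

`SubcylindricalExistence_of : floor → core → capping → upgrade → SubcylindricalExistence` is proved below
by six lines of logic (no `sorry`); the four `stub_*` theorems carry the only sorries.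

Disproof used.  The cdisprove record `Disproof.lean` (payload `disproof_path`) is not readable from the
planner jail (as for all three triagers); used: the item's evidence notes (Disproof v1–v6) and the LANDED
negative lemmas imported above.  There is no `_false_without_` theorem for this crux (it RESISTS:
ENT ⇔ SPC4 modulo RUNG, `Negative.Logic.subcylindricalExistence_iff_spc4`) — honoured: the SPC4-hard
content sits in ONE named stub, `stub_fatConeCore`, whose `M ≃ₕ S⁴` hypothesis is load-bearing (on
`T⁴ ∖ p` a fat `Ric ≥ 0` core is excluded by Anderson's `|π₁| ≤ 1/AVR`).  `Negative.ConstTest`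
(`subcylindricalWitness_totalScalar_sq`: any witness has `(∫R)² ≥ 128π^{5/2}e^{1/2}e^{δ}·Vol`) is met by
the capped witness, a `(1+o(1))`-round `S⁴(A)` (`(∫R)²/Vol → 384π²`, ratio `e^{0.026−δ}`);
`Negative.Window` (`margin_gt/lt`, `nuCyl_lt_nuRound`) is exactly the margin the cap spends; the refuted
`ForallStrengthening` (bubble-sheet metrics on `S⁴`) is not an instance of any stub (no stub quantifies
over all PSC metrics).  Negatives index: 0.
-/

noncomputable section

open scoped Manifold ContDiff Topology ENNReal NNReal ContinuousMap

set_option linter.dupNamespace false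
open Set Filter Function MeasureTheory
open Literature.Geometry.Lorentzian Literature.Geometry.Riemannian

namespace Summit.SmoothPoincare4.SmoothPoincare4.Cruxes.SubcylindricalExistence.FatConicalCoreAvrLogsobolev

open Summit.SmoothPoincare4.SmoothPoincare4.Theses.EntropyRung

/-! ## The four stub STATEMENTS as named `Prop`s

(`stub_*` below restate them verbatim — this file is not importable, so registered signatures must be
self-contained; `*_holds` certify the agreement definitionally; `Registered.stub_*` are the name-keyed
aliases used as the hypotheses of `SubcylindricalExistence_of`, the device of
`Cruxes/SomeWindowSaving/Lines/inert-box-collapse.lean` in summit ABC.) -/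

/-- **Fat exact-cone core data** on a closed 4-manifold `M` punctured at `p` — the common hypothesis
package of `FatConeCoreExistence` (∃-form) and `ConeCapping` (∀-form).  `P` is an abstract model of
`M ∖ {p}` (`ι` a smooth open embedding with injective differential onto `{p}ᶜ`) carrying the metric `h`;
(i) `h` is complete (closed `h.edist`-balls compact), `Ric_h ≥ 0`, asymptotic volume ratio
`Vol B_r(x)/(π²r⁴/2) → c³` at every `x`; (ii) `0 < ρ₀`, `0 < c ≤ 1`; (iii) CONE CHART: `ψ` is smooth and
injective on `{‖x‖ > ρ₀} ⊂ ℝ⁴`, covers the end (`P ∖ ψ{‖x‖ > ρ₀}` compact) and pulls `h` back to the flat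
cone of slope `c` over the round `S³`, `ψ*h = c²⟨X,Y⟩ + (1 − c²)⟨X,x⟩⟨Y,x⟩/‖x‖²` (`= dr² + c²r²g_{S³}`;
`Ric ≥ 0`, `R = 6(1−c²)/(c²r²)`, AVR `c³`); (iv) POLAR CHART AT `p`: `β` is smooth with injective
differential on the ball `‖y‖ < ρ₀⁻¹`, `β 0 = p`, and `β y = ι (ψ (y/‖y‖²))` for `y ≠ 0` — the cone's
large end is the puncture, seen through a genuine chart of `M` (no Schoenflies ambiguity). -/
def IsFatConeCore (M : Type) [TopologicalSpace M] [ChartedSpace (EuclideanSpace ℝ (Fin 4)) M]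
    (p : M) (P : Type) [TopologicalSpace P] [ChartedSpace (EuclideanSpace ℝ (Fin 4)) P]
    [IsManifold (𝓡 4) ∞ P] [T3Space P] [MeasurableSpace P] [BorelSpace P]
    (ι : P → M) (ψ : EuclideanSpace ℝ (Fin 4) → P) (β : EuclideanSpace ℝ (Fin 4) → M)
    (h : PseudoRiemannianMetric (𝓡 4) ∞ (EuclideanSpace ℝ (Fin 4)) (TangentSpace (𝓡 4) : P → Type _))
    [h.HasLeviCivita] (hh : h.IsRiemannian) (c ρ₀ : ℝ) : Prop :=
  ((∀ (x : P) (r : NNReal), IsCompact {y : P | h.edist hh x y ≤ r}) ∧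
    (∀ (x : P) (X : TangentSpace (𝓡 4) x), 0 ≤ h.ricci x X X) ∧
    (∀ x : P, Tendsto (fun r : ℝ ↦
      ((riemannianMeasure (h.toContMDiffRiemannianMetric hh))
        {y : P | h.edist hh x y ≤ ENNReal.ofReal r}).toReal / (Real.pi ^ 2 / 2 * r ^ 4))
      atTop (𝓝 (c ^ 3)))) ∧
  (0 < ρ₀ ∧ 0 < c ∧ c ≤ 1) ∧
  (Topology.IsOpenEmbedding ι ∧ ContMDiff (𝓡 4) (𝓡 4) ∞ ι ∧
    (∀ x : P, Injective (mfderiv (𝓡 4) (𝓡 4) ι x)) ∧ range ι = {p}ᶜ) ∧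
  (ContMDiffOn (𝓡 4) (𝓡 4) ∞ ψ {x | ρ₀ < ‖x‖} ∧ InjOn ψ {x | ρ₀ < ‖x‖} ∧
    IsCompact (ψ '' {x | ρ₀ < ‖x‖})ᶜ ∧
    (∀ x : EuclideanSpace ℝ (Fin 4), ρ₀ < ‖x‖ → ∀ X Y : EuclideanSpace ℝ (Fin 4),
      h.val (ψ x) (mfderiv (𝓡 4) (𝓡 4) ψ x X) (mfderiv (𝓡 4) (𝓡 4) ψ x Y) =
        c ^ 2 * inner ℝ X Y + (1 - c ^ 2) * (inner ℝ X x * inner ℝ Y x / ‖x‖ ^ 2))) ∧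
  (β 0 = p ∧ ContMDiffOn (𝓡 4) (𝓡 4) ∞ β (Metric.ball 0 ρ₀⁻¹) ∧
    (∀ y ∈ Metric.ball (0 : EuclideanSpace ℝ (Fin 4)) ρ₀⁻¹, Injective (mfderiv (𝓡 4) (𝓡 4) β y)) ∧
    (∀ y ∈ Metric.ball (0 : EuclideanSpace ℝ (Fin 4)) ρ₀⁻¹, y ≠ 0 → β y = ι (ψ ((‖y‖ ^ 2)⁻¹ • y))))

/-- **STUB 1 statement — AVR entropy floor** (Balogh–Kristály–Tripaldi arXiv:2210.15774 Thm 1.1, `p = 2`,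
`N = n = 4`, `𝒲`-normalised with the scale optimised and the `τ∫Ru ≥ 0` term dropped): a complete connected
non-compact `(P⁴, h)` with `Ric ≥ 0` and asymptotic volume ratio `θ > 0` has, for every `τ > 0` and every
smooth compactly supported `w` with `∫ (4πτ)⁻² w² dV = 1`,
`log θ ≤ ∫ [4τ|∇w|² − w² log w² − 4w²](4πτ)⁻² dV` (`= 𝒲(h, f, τ) − τ∫R u` at `u = (4πτ)⁻² e^{−f} = (4πτ)⁻² w²`).
Equality for flat `ℝ⁴` (`θ = 1`, Gaussians); `log ½` for Eguchi–Hanson-type ends `ℝ⁴/ℤ₂`. -/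
def AVREntropyFloor : Prop :=
  ∀ (P : Type) [TopologicalSpace P] [T2Space P] [SecondCountableTopology P]
    [ChartedSpace (EuclideanSpace ℝ (Fin 4)) P] [IsManifold (𝓡 4) ∞ P] [ConnectedSpace P]
    [NoncompactSpace P] [T3Space P] [MeasurableSpace P] [BorelSpace P]
    (h : PseudoRiemannianMetric (𝓡 4) ∞ (EuclideanSpace ℝ (Fin 4)) (TangentSpace (𝓡 4) : P → Type _))
    [h.HasLeviCivita] (hh : h.IsRiemannian) (θ : ℝ),
    (∀ (x : P) (r : NNReal), IsCompact {y : P | h.edist hh x y ≤ r}) →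
    (∀ (x : P) (X : TangentSpace (𝓡 4) x), 0 ≤ h.ricci x X X) → 0 < θ →
    (∀ x : P, Tendsto (fun r : ℝ ↦
      ((riemannianMeasure (h.toContMDiffRiemannianMetric hh))
        {y : P | h.edist hh x y ≤ ENNReal.ofReal r}).toReal / (Real.pi ^ 2 / 2 * r ^ 4))
      atTop (𝓝 θ)) →
    ∀ τ : ℝ, 0 < τ → ∀ w : P → ℝ, ContMDiff (𝓡 4) 𝓘(ℝ, ℝ) ∞ w → HasCompactSupport w →
      ∫ x, (4 * Real.pi * τ) ^ (-(4 : ℝ) / 2) * (w x) ^ 2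
          ∂(riemannianMeasure (h.toContMDiffRiemannianMetric hh)) = 1 →
        Real.log θ ≤ ∫ x, (4 * τ * h.gradSq w x - (w x) ^ 2 * Real.log ((w x) ^ 2)
            - 4 * (w x) ^ 2) * (4 * Real.pi * τ) ^ (-(4 : ℝ) / 2)
          ∂(riemannianMeasure (h.toContMDiffRiemannianMetric hh))

/-- **STUB 2 statement — fat exact-cone core existence** (the transferred crux C⁺; SPC4-hard): every closed
smooth homotopy 4-sphere `M` has a point `p` such that `M ∖ {p}` carries fat exact-cone core data
(`IsFatConeCore`) of slope `c` with `c³ > Θ(S³×ℝ) = 2√π e^{−3/2} ≈ 0.791` (`c > 0.925`).  TRUE on `S⁴`: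
`P = ℝ⁴` flat, `ι` = inverse stereographic projection from `p`, `ψ = id`, `β` = inverse stereographic
projection from `−p`, `c = 1`.  For an exotic `M` it fails iff ENT does (modulo the other three stubs and
RUNG); independent content: the conjecture `G_AVR(4)` "complete `Ric ≥ 0`, AVR `> Θ(S³×ℝ)` on `M⁴` ⇒
`M ≅ ℝ⁴`", known for AVR `≥ 1 − δ(4)` (Cheeger–Colding 1997 Thm A.1.11) and `π₁ = 1` for AVR `> 1/2`. -/
def FatConeCoreExistence : Prop :=
  ∀ (M : Type) [TopologicalSpace M] [T2Space M] [SecondCountableTopology M]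
    [ChartedSpace (EuclideanSpace ℝ (Fin 4)) M] [IsManifold (𝓡 4) ∞ M] [CompactSpace M]
    [T3Space M] [MeasurableSpace M] [BorelSpace M],
    M ≃ₕ Metric.sphere (0 : EuclideanSpace ℝ (Fin 5)) 1 →
    ∃ (p : M) (P : Type) (_ : TopologicalSpace P) (_ : T2Space P) (_ : SecondCountableTopology P)
      (_ : ChartedSpace (EuclideanSpace ℝ (Fin 4)) P) (_ : IsManifold (𝓡 4) ∞ P) (_ : ConnectedSpace P)
      (_ : NoncompactSpace P) (_ : T3Space P) (_ : MeasurableSpace P) (_ : BorelSpace P)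
      (ι : P → M) (ψ : EuclideanSpace ℝ (Fin 4) → P) (β : EuclideanSpace ℝ (Fin 4) → M)
      (h : PseudoRiemannianMetric (𝓡 4) ∞ (EuclideanSpace ℝ (Fin 4)) (TangentSpace (𝓡 4) : P → Type _))
      (_ : h.HasLeviCivita) (hh : h.IsRiemannian) (c ρ₀ : ℝ),
      IsFatConeCore M p P ι ψ β h hh c ρ₀ ∧ 2 * Real.sqrt Real.pi * Real.exp (-(3 : ℝ) / 2) < c ^ 3

/-- **STUB 3 statement — cone capping (the closing lemma)**: on ANY closed smooth 4-manifold `M`, fat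
exact-cone core data at `p` with `c³ > Θ(S³×ℝ)` whose metric satisfies the entropy floor at level
`log c³` (the conclusion of `AVREntropyFloor` for `(P, h)`) can be truncated, opened slowly and capped by a
round cap INSIDE `M` (through the polar chart `β`) to a Riemannian metric `g` on `M` with `R ≥ 0`
everywhere, `R > 0` somewhere (in fact off the core) and `ν(g) > ν_cyl` — the crux's entropy clause
verbatim.  Informal proof: module docstring; its numerical falsifier is the card's F2 (radial `𝒲` on the
cohomogeneity-one models). -/
def ConeCapping : Prop :=
  ∀ (M : Type) [TopologicalSpace M] [T2Space M] [SecondCountableTopology M]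
    [ChartedSpace (EuclideanSpace ℝ (Fin 4)) M] [IsManifold (𝓡 4) ∞ M] [CompactSpace M]
    [T3Space M] [MeasurableSpace M] [BorelSpace M]
    (p : M) (P : Type) [TopologicalSpace P] [T2Space P] [SecondCountableTopology P]
    [ChartedSpace (EuclideanSpace ℝ (Fin 4)) P] [IsManifold (𝓡 4) ∞ P] [ConnectedSpace P]
    [NoncompactSpace P] [T3Space P] [MeasurableSpace P] [BorelSpace P]
    (ι : P → M) (ψ : EuclideanSpace ℝ (Fin 4) → P) (β : EuclideanSpace ℝ (Fin 4) → M)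
    (h : PseudoRiemannianMetric (𝓡 4) ∞ (EuclideanSpace ℝ (Fin 4)) (TangentSpace (𝓡 4) : P → Type _))
    [h.HasLeviCivita] (hh : h.IsRiemannian) (c ρ₀ : ℝ),
    IsFatConeCore M p P ι ψ β h hh c ρ₀ → 2 * Real.sqrt Real.pi * Real.exp (-(3 : ℝ) / 2) < c ^ 3 →
    (∀ τ : ℝ, 0 < τ → ∀ w : P → ℝ, ContMDiff (𝓡 4) 𝓘(ℝ, ℝ) ∞ w → HasCompactSupport w →
      ∫ x, (4 * Real.pi * τ) ^ (-(4 : ℝ) / 2) * (w x) ^ 2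
          ∂(riemannianMeasure (h.toContMDiffRiemannianMetric hh)) = 1 →
        Real.log (c ^ 3) ≤ ∫ x, (4 * τ * h.gradSq w x - (w x) ^ 2 * Real.log ((w x) ^ 2)
            - 4 * (w x) ^ 2) * (4 * Real.pi * τ) ^ (-(4 : ℝ) / 2)
          ∂(riemannianMeasure (h.toContMDiffRiemannianMetric hh))) →
    ∃ g : PseudoRiemannianMetric (𝓡 4) ∞ (EuclideanSpace ℝ (Fin 4)) (TangentSpace (𝓡 4) : M → Type _),
      ∃ _ : g.HasLeviCivita, ∃ hg : g.IsRiemannian,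
        (∀ x : M, 0 ≤ g.scalarCurvature x) ∧ (∃ x : M, 0 < g.scalarCurvature x) ∧
        ∃ δ : ℝ, 0 < δ ∧ ∀ τ : ℝ, 0 < τ → ∀ f : M → ℝ, ContMDiff (𝓡 4) 𝓘(ℝ, ℝ) ∞ f →
          ∫ x, (4 * Real.pi * τ) ^ (-(4 : ℝ) / 2) * Real.exp (-f x)
              ∂(riemannianMeasure (g.toContMDiffRiemannianMetric hg)) = 1 →
            Real.log 2 + Real.log Real.pi / 2 - 3 / 2 + δ ≤
              ∫ x, (τ * (g.scalarCurvature x + g.gradSq f x) + f x - 4) *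
                ((4 * Real.pi * τ) ^ (-(4 : ℝ) / 2) * Real.exp (-f x))
                ∂(riemannianMeasure (g.toContMDiffRiemannianMetric hg))

/-- **STUB 4 statement — positivity upgrade**: on a closed smooth 4-manifold, a Riemannian metric with
`R ≥ 0` everywhere, `R > 0` somewhere and `ν > ν₀` (the crux's clause at an arbitrary level `ν₀`) can be
replaced by one with `R > 0` everywhere and still `ν > ν₀`.  Proof sketch: `g_ε = (1 + εv)² g` with
`−6Δ_g v = R_avg − R` has `R_ε = (1+εv)⁻³((1−ε)R + εR_avg + εRv) > 0` for small `ε`; three scale regimes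
with an `ε`-INDEPENDENT window: `μ(g', τ) ≥ −C τ` for `τ ≤ τ₁` uniformly for `g'` `C²`-near `g` (and
`ν₀ + δ ≤ ν(g) ≤ 0` forces `ν₀ + δ/2 < 0`); `𝒲_{g'} ≥ τ λ₁(−2Δ_{g'} + R_{g'}) − C_LSI(g') − 2 log(4πτ) − 4 → +∞`
for `τ ≥ τ₃`, with `λ₁ > 0` because `R ≥ 0`, `R ≢ 0` on every component (a scalar-flat component would make
`μ(g, τ) → −∞`, contradicting the hypothesis) and `λ₁`, `C_LSI` stable under small perturbation; and
`|μ(g_ε, τ) − μ(g, τ)| → 0` uniformly on the fixed compact window `[τ₁, τ₃]`.  Vacuous for `ν₀ ≥ 0`. -/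
def ScalarPositiveUpgrade : Prop :=
  ∀ (M : Type) [TopologicalSpace M] [T2Space M] [SecondCountableTopology M]
    [ChartedSpace (EuclideanSpace ℝ (Fin 4)) M] [IsManifold (𝓡 4) ∞ M] [CompactSpace M]
    [T3Space M] [MeasurableSpace M] [BorelSpace M]
    (g : PseudoRiemannianMetric (𝓡 4) ∞ (EuclideanSpace ℝ (Fin 4)) (TangentSpace (𝓡 4) : M → Type _))
    [g.HasLeviCivita] (hg : g.IsRiemannian) (ν₀ : ℝ),
    (∀ x : M, 0 ≤ g.scalarCurvature x) → (∃ x : M, 0 < g.scalarCurvature x) →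
    (∃ δ : ℝ, 0 < δ ∧ ∀ τ : ℝ, 0 < τ → ∀ f : M → ℝ, ContMDiff (𝓡 4) 𝓘(ℝ, ℝ) ∞ f →
      ∫ x, (4 * Real.pi * τ) ^ (-(4 : ℝ) / 2) * Real.exp (-f x)
          ∂(riemannianMeasure (g.toContMDiffRiemannianMetric hg)) = 1 →
        ν₀ + δ ≤ ∫ x, (τ * (g.scalarCurvature x + g.gradSq f x) + f x - 4) *
          ((4 * Real.pi * τ) ^ (-(4 : ℝ) / 2) * Real.exp (-f x))
          ∂(riemannianMeasure (g.toContMDiffRiemannianMetric hg))) →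
    ∃ g' : PseudoRiemannianMetric (𝓡 4) ∞ (EuclideanSpace ℝ (Fin 4)) (TangentSpace (𝓡 4) : M → Type _),
      ∃ _ : g'.HasLeviCivita, ∃ hg' : g'.IsRiemannian,
        (∀ x : M, 0 < g'.scalarCurvature x) ∧
        ∃ δ : ℝ, 0 < δ ∧ ∀ τ : ℝ, 0 < τ → ∀ f : M → ℝ, ContMDiff (𝓡 4) 𝓘(ℝ, ℝ) ∞ f →
          ∫ x, (4 * Real.pi * τ) ^ (-(4 : ℝ) / 2) * Real.exp (-f x)
              ∂(riemannianMeasure (g'.toContMDiffRiemannianMetric hg')) = 1 →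
            ν₀ + δ ≤ ∫ x, (τ * (g'.scalarCurvature x + g'.gradSq f x) + f x - 4) *
              ((4 * Real.pi * τ) ^ (-(4 : ℝ) / 2) * Real.exp (-f x))
              ∂(riemannianMeasure (g'.toContMDiffRiemannianMetric hg'))

/-! ## The registered stubs (`sorry` lives only in these four theorems; statements VERBATIM, with
`IsFatConeCore` unfolded, so that each registered signature is self-contained) -/

/-- **STUB 1 · `stub_avrEntropyFloor`** — `AVREntropyFloor` verbatim: BKT arXiv:2210.15774 Thm 1.1
(`p = 2`, `N = 4`) in `𝒲`-form, `log θ ≤ ∫[4τ|∇w|² − w² log w² − 4w²](4πτ)⁻² dV` on complete connected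
non-compact `Ric ≥ 0` 4-manifolds of AVR `θ` (published theorem; inputs Brendle 2009.13717 /
Balogh–Kristály 2012.11862; size XL in Lean — a Literature named-fact candidate). -/
theorem stub_avrEntropyFloor :
    ∀ (P : Type) [TopologicalSpace P] [T2Space P] [SecondCountableTopology P]
    [ChartedSpace (EuclideanSpace ℝ (Fin 4)) P] [IsManifold (𝓡 4) ∞ P] [ConnectedSpace P]
    [NoncompactSpace P] [T3Space P] [MeasurableSpace P] [BorelSpace P]
    (h : PseudoRiemannianMetric (𝓡 4) ∞ (EuclideanSpace ℝ (Fin 4)) (TangentSpace (𝓡 4) : P → Type _))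
    [h.HasLeviCivita] (hh : h.IsRiemannian) (θ : ℝ),
    (∀ (x : P) (r : NNReal), IsCompact {y : P | h.edist hh x y ≤ r}) →
    (∀ (x : P) (X : TangentSpace (𝓡 4) x), 0 ≤ h.ricci x X X) → 0 < θ →
    (∀ x : P, Tendsto (fun r : ℝ ↦
      ((riemannianMeasure (h.toContMDiffRiemannianMetric hh))
        {y : P | h.edist hh x y ≤ ENNReal.ofReal r}).toReal / (Real.pi ^ 2 / 2 * r ^ 4))
      atTop (𝓝 θ)) →
    ∀ τ : ℝ, 0 < τ → ∀ w : P → ℝ, ContMDiff (𝓡 4) 𝓘(ℝ, ℝ) ∞ w → HasCompactSupport w →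
      ∫ x, (4 * Real.pi * τ) ^ (-(4 : ℝ) / 2) * (w x) ^ 2
          ∂(riemannianMeasure (h.toContMDiffRiemannianMetric hh)) = 1 →
        Real.log θ ≤ ∫ x, (4 * τ * h.gradSq w x - (w x) ^ 2 * Real.log ((w x) ^ 2)
            - 4 * (w x) ^ 2) * (4 * Real.pi * τ) ^ (-(4 : ℝ) / 2)
          ∂(riemannianMeasure (h.toContMDiffRiemannianMetric hh)) := by
  sorry

/-- **STUB 2 · `stub_fatConeCore`** — `FatConeCoreExistence` verbatim (the transferred crux C⁺, the
line's hardest stub, SPC4-hard for exotic `M`; true on `S⁴` with the flat core): every closed smooth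
homotopy 4-sphere punctured at some point carries a complete `Ric ≥ 0` metric that is exactly the flat
cone of slope `c` over the round `S³` outside a compact set, seen through the inversion of a polar chart
at the puncture, with `c³ > 2√π e^{−3/2}`. -/
theorem stub_fatConeCore :
    ∀ (M : Type) [TopologicalSpace M] [T2Space M] [SecondCountableTopology M]
    [ChartedSpace (EuclideanSpace ℝ (Fin 4)) M] [IsManifold (𝓡 4) ∞ M] [CompactSpace M]
    [T3Space M] [MeasurableSpace M] [BorelSpace M],
    M ≃ₕ Metric.sphere (0 : EuclideanSpace ℝ (Fin 5)) 1 →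
    ∃ (p : M) (P : Type) (_ : TopologicalSpace P) (_ : T2Space P) (_ : SecondCountableTopology P)
      (_ : ChartedSpace (EuclideanSpace ℝ (Fin 4)) P) (_ : IsManifold (𝓡 4) ∞ P) (_ : ConnectedSpace P)
      (_ : NoncompactSpace P) (_ : T3Space P) (_ : MeasurableSpace P) (_ : BorelSpace P)
      (ι : P → M) (ψ : EuclideanSpace ℝ (Fin 4) → P) (β : EuclideanSpace ℝ (Fin 4) → M)
      (h : PseudoRiemannianMetric (𝓡 4) ∞ (EuclideanSpace ℝ (Fin 4)) (TangentSpace (𝓡 4) : P → Type _))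
      (_ : h.HasLeviCivita) (hh : h.IsRiemannian) (c ρ₀ : ℝ),
      (((∀ (x : P) (r : NNReal), IsCompact {y : P | h.edist hh x y ≤ r}) ∧
          (∀ (x : P) (X : TangentSpace (𝓡 4) x), 0 ≤ h.ricci x X X) ∧
          (∀ x : P, Tendsto (fun r : ℝ ↦
            ((riemannianMeasure (h.toContMDiffRiemannianMetric hh))
              {y : P | h.edist hh x y ≤ ENNReal.ofReal r}).toReal / (Real.pi ^ 2 / 2 * r ^ 4))
            atTop (𝓝 (c ^ 3)))) ∧
        (0 < ρ₀ ∧ 0 < c ∧ c ≤ 1) ∧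
        (Topology.IsOpenEmbedding ι ∧ ContMDiff (𝓡 4) (𝓡 4) ∞ ι ∧
          (∀ x : P, Injective (mfderiv (𝓡 4) (𝓡 4) ι x)) ∧ range ι = {p}ᶜ) ∧
        (ContMDiffOn (𝓡 4) (𝓡 4) ∞ ψ {x | ρ₀ < ‖x‖} ∧ InjOn ψ {x | ρ₀ < ‖x‖} ∧
          IsCompact (ψ '' {x | ρ₀ < ‖x‖})ᶜ ∧
          (∀ x : EuclideanSpace ℝ (Fin 4), ρ₀ < ‖x‖ → ∀ X Y : EuclideanSpace ℝ (Fin 4),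
            h.val (ψ x) (mfderiv (𝓡 4) (𝓡 4) ψ x X) (mfderiv (𝓡 4) (𝓡 4) ψ x Y) =
              c ^ 2 * inner ℝ X Y + (1 - c ^ 2) * (inner ℝ X x * inner ℝ Y x / ‖x‖ ^ 2))) ∧
        (β 0 = p ∧ ContMDiffOn (𝓡 4) (𝓡 4) ∞ β (Metric.ball 0 ρ₀⁻¹) ∧
          (∀ y ∈ Metric.ball (0 : EuclideanSpace ℝ (Fin 4)) ρ₀⁻¹,
            Injective (mfderiv (𝓡 4) (𝓡 4) β y)) ∧
          (∀ y ∈ Metric.ball (0 : EuclideanSpace ℝ (Fin 4)) ρ₀⁻¹, y ≠ 0 →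
            β y = ι (ψ ((‖y‖ ^ 2)⁻¹ • y))))) ∧
      2 * Real.sqrt Real.pi * Real.exp (-(3 : ℝ) / 2) < c ^ 3 := by
  sorry

/-- **STUB 3 · `stub_coneCapping`** — `ConeCapping` verbatim (the closing lemma; new, size L on paper /
XL in Lean): fat exact-cone core data at `p` on a closed 4-manifold `M` + the entropy floor
`log c³ ≤ 𝒲 − τ∫Ru` on the core + `c³ > 2√π e^{−3/2}` ⇒ a metric on `M` with `R ≥ 0`, `R > 0` somewhere,
`ν > ν_cyl`.  Slow opening + huge round cap; `𝒲`-localisation (IMS + concavity of entropy), Hardy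
absorption of logarithmic cut-offs, Holley–Stroock comparison of opening annuli with exact cones,
RoundBound `ν(S⁴) = log 6 − 2` for the cap. -/
theorem stub_coneCapping :
    ∀ (M : Type) [TopologicalSpace M] [T2Space M] [SecondCountableTopology M]
    [ChartedSpace (EuclideanSpace ℝ (Fin 4)) M] [IsManifold (𝓡 4) ∞ M] [CompactSpace M]
    [T3Space M] [MeasurableSpace M] [BorelSpace M]
    (p : M) (P : Type) [TopologicalSpace P] [T2Space P] [SecondCountableTopology P]
    [ChartedSpace (EuclideanSpace ℝ (Fin 4)) P] [IsManifold (𝓡 4) ∞ P] [ConnectedSpace P]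
    [NoncompactSpace P] [T3Space P] [MeasurableSpace P] [BorelSpace P]
    (ι : P → M) (ψ : EuclideanSpace ℝ (Fin 4) → P) (β : EuclideanSpace ℝ (Fin 4) → M)
    (h : PseudoRiemannianMetric (𝓡 4) ∞ (EuclideanSpace ℝ (Fin 4)) (TangentSpace (𝓡 4) : P → Type _))
    [h.HasLeviCivita] (hh : h.IsRiemannian) (c ρ₀ : ℝ),
    (((∀ (x : P) (r : NNReal), IsCompact {y : P | h.edist hh x y ≤ r}) ∧
          (∀ (x : P) (X : TangentSpace (𝓡 4) x), 0 ≤ h.ricci x X X) ∧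
          (∀ x : P, Tendsto (fun r : ℝ ↦
            ((riemannianMeasure (h.toContMDiffRiemannianMetric hh))
              {y : P | h.edist hh x y ≤ ENNReal.ofReal r}).toReal / (Real.pi ^ 2 / 2 * r ^ 4))
            atTop (𝓝 (c ^ 3)))) ∧
        (0 < ρ₀ ∧ 0 < c ∧ c ≤ 1) ∧
        (Topology.IsOpenEmbedding ι ∧ ContMDiff (𝓡 4) (𝓡 4) ∞ ι ∧
          (∀ x : P, Injective (mfderiv (𝓡 4) (𝓡 4) ι x)) ∧ range ι = {p}ᶜ) ∧
        (ContMDiffOn (𝓡 4) (𝓡 4) ∞ ψ {x | ρ₀ < ‖x‖} ∧ InjOn ψ {x | ρ₀ < ‖x‖} ∧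
          IsCompact (ψ '' {x | ρ₀ < ‖x‖})ᶜ ∧
          (∀ x : EuclideanSpace ℝ (Fin 4), ρ₀ < ‖x‖ → ∀ X Y : EuclideanSpace ℝ (Fin 4),
            h.val (ψ x) (mfderiv (𝓡 4) (𝓡 4) ψ x X) (mfderiv (𝓡 4) (𝓡 4) ψ x Y) =
              c ^ 2 * inner ℝ X Y + (1 - c ^ 2) * (inner ℝ X x * inner ℝ Y x / ‖x‖ ^ 2))) ∧
        (β 0 = p ∧ ContMDiffOn (𝓡 4) (𝓡 4) ∞ β (Metric.ball 0 ρ₀⁻¹) ∧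
          (∀ y ∈ Metric.ball (0 : EuclideanSpace ℝ (Fin 4)) ρ₀⁻¹,
            Injective (mfderiv (𝓡 4) (𝓡 4) β y)) ∧
          (∀ y ∈ Metric.ball (0 : EuclideanSpace ℝ (Fin 4)) ρ₀⁻¹, y ≠ 0 →
            β y = ι (ψ ((‖y‖ ^ 2)⁻¹ • y))))) →
    2 * Real.sqrt Real.pi * Real.exp (-(3 : ℝ) / 2) < c ^ 3 →
    (∀ τ : ℝ, 0 < τ → ∀ w : P → ℝ, ContMDiff (𝓡 4) 𝓘(ℝ, ℝ) ∞ w → HasCompactSupport w →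
      ∫ x, (4 * Real.pi * τ) ^ (-(4 : ℝ) / 2) * (w x) ^ 2
          ∂(riemannianMeasure (h.toContMDiffRiemannianMetric hh)) = 1 →
        Real.log (c ^ 3) ≤ ∫ x, (4 * τ * h.gradSq w x - (w x) ^ 2 * Real.log ((w x) ^ 2)
            - 4 * (w x) ^ 2) * (4 * Real.pi * τ) ^ (-(4 : ℝ) / 2)
          ∂(riemannianMeasure (h.toContMDiffRiemannianMetric hh))) →
    ∃ g : PseudoRiemannianMetric (𝓡 4) ∞ (EuclideanSpace ℝ (Fin 4)) (TangentSpace (𝓡 4) : M → Type _),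
      ∃ _ : g.HasLeviCivita, ∃ hg : g.IsRiemannian,
        (∀ x : M, 0 ≤ g.scalarCurvature x) ∧ (∃ x : M, 0 < g.scalarCurvature x) ∧
        ∃ δ : ℝ, 0 < δ ∧ ∀ τ : ℝ, 0 < τ → ∀ f : M → ℝ, ContMDiff (𝓡 4) 𝓘(ℝ, ℝ) ∞ f →
          ∫ x, (4 * Real.pi * τ) ^ (-(4 : ℝ) / 2) * Real.exp (-f x)
              ∂(riemannianMeasure (g.toContMDiffRiemannianMetric hg)) = 1 →
            Real.log 2 + Real.log Real.pi / 2 - 3 / 2 + δ ≤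
              ∫ x, (τ * (g.scalarCurvature x + g.gradSq f x) + f x - 4) *
                ((4 * Real.pi * τ) ^ (-(4 : ℝ) / 2) * Real.exp (-f x))
                ∂(riemannianMeasure (g.toContMDiffRiemannianMetric hg)) := by
  sorry

/-- **STUB 4 · `stub_scalarPositiveUpgrade`** — `ScalarPositiveUpgrade` verbatim (size M on paper / L–XL
in Lean: conformal perturbation `(1 + εv)²g`, `−6Δv = R_avg − R`, plus continuity of `μ` on compact
scale windows and the two ends `τ → 0`, `τ → ∞`). -/
theorem stub_scalarPositiveUpgrade :
    ∀ (M : Type) [TopologicalSpace M] [T2Space M] [SecondCountableTopology M]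
    [ChartedSpace (EuclideanSpace ℝ (Fin 4)) M] [IsManifold (𝓡 4) ∞ M] [CompactSpace M]
    [T3Space M] [MeasurableSpace M] [BorelSpace M]
    (g : PseudoRiemannianMetric (𝓡 4) ∞ (EuclideanSpace ℝ (Fin 4)) (TangentSpace (𝓡 4) : M → Type _))
    [g.HasLeviCivita] (hg : g.IsRiemannian) (ν₀ : ℝ),
    (∀ x : M, 0 ≤ g.scalarCurvature x) → (∃ x : M, 0 < g.scalarCurvature x) →
    (∃ δ : ℝ, 0 < δ ∧ ∀ τ : ℝ, 0 < τ → ∀ f : M → ℝ, ContMDiff (𝓡 4) 𝓘(ℝ, ℝ) ∞ f →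
      ∫ x, (4 * Real.pi * τ) ^ (-(4 : ℝ) / 2) * Real.exp (-f x)
          ∂(riemannianMeasure (g.toContMDiffRiemannianMetric hg)) = 1 →
        ν₀ + δ ≤ ∫ x, (τ * (g.scalarCurvature x + g.gradSq f x) + f x - 4) *
          ((4 * Real.pi * τ) ^ (-(4 : ℝ) / 2) * Real.exp (-f x))
          ∂(riemannianMeasure (g.toContMDiffRiemannianMetric hg))) →
    ∃ g' : PseudoRiemannianMetric (𝓡 4) ∞ (EuclideanSpace ℝ (Fin 4)) (TangentSpace (𝓡 4) : M → Type _),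
      ∃ _ : g'.HasLeviCivita, ∃ hg' : g'.IsRiemannian,
        (∀ x : M, 0 < g'.scalarCurvature x) ∧
        ∃ δ : ℝ, 0 < δ ∧ ∀ τ : ℝ, 0 < τ → ∀ f : M → ℝ, ContMDiff (𝓡 4) 𝓘(ℝ, ℝ) ∞ f →
          ∫ x, (4 * Real.pi * τ) ^ (-(4 : ℝ) / 2) * Real.exp (-f x)
              ∂(riemannianMeasure (g'.toContMDiffRiemannianMetric hg')) = 1 →
            ν₀ + δ ≤ ∫ x, (τ * (g'.scalarCurvature x + g'.gradSq f x) + f x - 4) *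
              ((4 * Real.pi * τ) ^ (-(4 : ℝ) / 2) * Real.exp (-f x))
              ∂(riemannianMeasure (g'.toContMDiffRiemannianMetric hg')) := by
  sorry

/-! ### Consistency: each named statement IS its registered stub (definitionally) -/

theorem avrEntropyFloor_holds : AVREntropyFloor := stub_avrEntropyFloor
theorem fatConeCoreExistence_holds : FatConeCoreExistence := stub_fatConeCore
theorem coneCapping_holds : ConeCapping := stub_coneCapping
theorem scalarPositiveUpgrade_holds : ScalarPositiveUpgrade := stub_scalarPositiveUpgrade

/-! ### Name-keyed aliases of the four statements (the hypotheses of the composition) -/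
namespace Registered

/-- Alias of `AVREntropyFloor` keyed by the registered stub name. -/
abbrev stub_avrEntropyFloor : Prop := AVREntropyFloor
/-- Alias of `FatConeCoreExistence` keyed by the registered stub name. -/
abbrev stub_fatConeCore : Prop := FatConeCoreExistence
/-- Alias of `ConeCapping` keyed by the registered stub name. -/
abbrev stub_coneCapping : Prop := ConeCapping
/-- Alias of `ScalarPositiveUpgrade` keyed by the registered stub name. -/
abbrev stub_scalarPositiveUpgrade : Prop := ScalarPositiveUpgrade

end Registered

/-! ## The composition: the four stubs imply the crux, BY NAME (kernel-checked; no `sorry` below) -/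

/-- **`SubcylindricalExistence_of`** — the glue of the line: for `M ≃ₕ S⁴`, the core stub gives
`(p, P, ι, ψ, β, h, c, ρ₀)`; the floor stub at `θ = c³` turns (complete, `Ric ≥ 0`, AVR `c³`) into the
scale-uniform entropy floor `log c³ ≤ 𝒲 − τ∫Ru` on the core; the capping stub closes it up inside `M` to an
`R ≥ 0`, `R ≢ 0`, `ν > ν_cyl` metric; the upgrade stub makes `R > 0` — which is ENT for `M`, verbatim. -/
theorem SubcylindricalExistence_of (hFloor : Registered.stub_avrEntropyFloor)
    (hCore : Registered.stub_fatConeCore) (hCap : Registered.stub_coneCapping)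
    (hUp : Registered.stub_scalarPositiveUpgrade) :
    Summit.SmoothPoincare4.SmoothPoincare4.Theses.EntropyRung.SubcylindricalExistence := by
  intro M _ _ _ _ _ _ _ _ _ e
  obtain ⟨p, P, _, _, _, _, _, _, _, _, _, _, ι, ψ, β, h, _, hh, c, ρ₀, hcore, hc3⟩ := hCore M e
  -- the floor on the core `(P, h)` at `θ = c³`
  have hfl := hFloor P h hh (c ^ 3) hcore.1.1 hcore.1.2.1 (pow_pos hcore.2.1.2.1 3) hcore.1.2.2
  -- cap it off inside `M`, then make the scalar curvature positive
  obtain ⟨g, _, hg, hR0, hRpos, hν⟩ := hCap M p P ι ψ β h hh c ρ₀ hcore hc3 hfl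
  obtain ⟨g', hLC', hg', hR', hν'⟩ :=
    hUp M g hg (Real.log 2 + Real.log Real.pi / 2 - 3 / 2) hR0 hRpos hν
  exact ⟨g', hLC', hg', hR', hν'⟩

/-- Wiring check: the registered stubs feed `SubcylindricalExistence_of` as stated. -/
example : Summit.SmoothPoincare4.SmoothPoincare4.Theses.EntropyRung.SubcylindricalExistence :=
  SubcylindricalExistence_of stub_avrEntropyFloor stub_fatConeCore stub_coneCapping
    stub_scalarPositiveUpgrade

/-! ## Sanity lemmas about the numbers of the line (sorry-free) -/

/-- The slope threshold: `c³ > Θ(S³×ℝ) = 2√π e^{−3/2}` is `log c³ > ν_cyl`, i.e. the floor the core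
delivers beats the crux level: `3 log c = log (c³) > log 2 + ½ log π − 3/2`. -/
theorem log_threshold {c : ℝ} (h : 2 * Real.sqrt Real.pi * Real.exp (-(3 : ℝ) / 2) < c ^ 3) :
    Real.log 2 + Real.log Real.pi / 2 - 3 / 2 < Real.log (c ^ 3) := by
  have hpos : 0 < 2 * Real.sqrt Real.pi * Real.exp (-(3 : ℝ) / 2) := by positivity
  have hlog := Real.log_lt_log hpos h
  have hsqrt : Real.log (Real.sqrt Real.pi) = Real.log Real.pi / 2 := by
    rw [Real.sqrt_eq_rpow, Real.log_rpow Real.pi_pos]; ring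
  rw [Real.log_mul (by positivity) (Real.exp_pos _).ne', Real.log_mul (by norm_num) (by positivity),
    Real.log_exp, hsqrt] at hlog
  linarith

/-- The cap's margin is the route's: the round cap contributes `ν_round = log 6 − 2 > ν_cyl`
(`Negative.Window.nuCyl_lt_nuRound`, margin in `(0.026, 0.0263)` by `margin_gt/lt`), so
`min(log c³, ν_round) > ν_cyl` — the level the capping stub must not lose more than `o(1)` from. -/
theorem cap_margin {c : ℝ} (h : 2 * Real.sqrt Real.pi * Real.exp (-(3 : ℝ) / 2) < c ^ 3) :
    Real.log 2 + Real.log Real.pi / 2 - 3 / 2 < min (Real.log (c ^ 3)) (Real.log 6 - 2) :=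
  lt_min (log_threshold h) Summit.SmoothPoincare4.Cruxes.SubcylindricalExistence.Negative.nuCyl_lt_nuRound

end Summit.SmoothPoincare4.SmoothPoincare4.Cruxes.SubcylindricalExistence.FatConicalCoreAvrLogsobolev

end
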